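import Literature.Geometry.Kaehler.ChernCharacterIndependenceProofs
import Literature.Geometry.Kaehler.ManifoldFormsPullback
import HarnessLib

/-!
# Naturality of the Chern–Weil construction: pull-back of cocycles, connections and Chern character forms; vanishing on a trivialising set

Layer `Literature/Geometry/Kaehler`. For a `C^∞` complex vector bundle presented by a cocycle
`V = (U_i, g_ij)` on a real-`C^∞` manifold `M` (`ComplexVectorBundle`), a connection `D = (ω_i)` on
it, and a `C^∞` map `f : N → M` of manifolds, S. Kobayashi, *Differential Geometry of Complex
Vector Bundles* (1987), Ch. II §1, Axiom 2 of the Chern classes, verbatim: "(Naturality)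
`c(f⁻¹E) = f^*(c(E)) ∈ H^*(M, Z)`" (for the induced bundle `f⁻¹E` of Ch. I §1, presented by the
cocycle `g_{VU} ∘ f` on the cover `f⁻¹(U)`, with the induced connection of Ch. I §1, (1.20)–(1.21):
"its connection form is `f^*ω_U`"), proved in Ch. II §2 for the Chern–Weil forms through
`f^*(dω + ω ∧ ω) = d(f^*ω) + f^*ω ∧ f^*ω`. This file PROVES the form-level and de Rham-level
naturality, and the local triviality of the Chern character:

* `MatrixForm.pullback` — entrywise pull-back `f^*A` of a matrix of forms, with its algebra
  (`f^*` commutes with sums, scalars, function factors `g ↦ g ∘ f`, `∧`, degree casts, wedge powers,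
  traces; purely algebraic, Warner 2.22(c));
* `SmoothComplexVectorBundle.pullback V f hf` — **the induced cocycle `f⁻¹V`** (`f⁻¹(U_i)`,
  `g_ij ∘ f`); `Connection.pullback D f hf` — **the induced connection** (`f^*ω_i`; the gauge law
  (1.16) pulls back because `d(g ∘ f) = f^*(dg)`, Warner 2.23);
* `Connection.curvature_pullback_apply`, `Connection.chernCharacterForm_pullback_apply`,
  `Connection.IsChernCharacterForm.pullback` — **`Ω(f⁻¹V, f^*D) = f^*Ω` and
  `ch_k(f⁻¹V, f^*D) = f^* ch_k(V, D)`** at the points of `f⁻¹(U_i)`, so that the pull-back of a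
  global Chern character form of `D` is one of `f^*D`;
* `SmoothComplexVectorBundle.map_mk_mem_chernCharacterClassSet`,
  `SmoothComplexVectorBundle.chernCharacterDeRham_pullback` — **naturality in de Rham cohomology**:
  `f^*[ch_k(V, D)] ∈` the Chern–Weil classes of `f⁻¹V`, and `ch_k(f⁻¹V) = f^* ch_k(V)` (granted the
  two Chern–Weil facts of `ChernCharacter.lean`, both discharged in the tree);
* `SmoothComplexVectorBundle.Connection.flat` — on a cocycle one of whose trivialising sets is all
  of `M` (`U_{i₀} = M`), **the flat connection `D s_{i₀} = 0` of the global frame `s_{i₀}`**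
  (`ω_j = g_{j i₀} dg_{i₀ j}`), whose Chern character forms of positive degree vanish
  (`isChernCharacterForm_zero_flat`); hence, by Chern–Weil II, **every global Chern character form
  of positive degree of every connection on such a cocycle is exact**
  (`Connection.IsChernCharacterForm.mk_eq_zero_of_baseSet_eq_univ`);
* `Connection.IsChernCharacterForm.map_mk_eq_zero_of_subset_baseSet` — **the Chern character dies on
  every trivialising open set**: for an open `W ⊆ U_{i₀}`, the restriction to the open submanifold
  `W` of the class of a global `ch_{k+1}`-form of any connection vanishes in `H^{2k+2}_dR(W; ℂ)`
  (the mechanism of Voisin I, proof of Thm. 11.33: "the Chern class `c₁(Lᵢ)` vanishes on `X − Dᵢ`,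
  since `Lᵢ` is trivial on `X − Dᵢ`", in every rank and degree).

Everything is proved; no definitions of `Prop`s, no named facts.

## References

* S. Kobayashi, *Differential Geometry of Complex Vector Bundles*, Iwanami/Princeton (1987), Ch. I §1
  (1.12), (1.16), (1.20)–(1.21); Ch. II §1 Axiom 2, §2 (2.21) and Thm. 2.16.
* C. Voisin, *Hodge Theory and Complex Algebraic Geometry I*, CUP (2002), proof of Thm. 11.33.
* F. W. Warner, *Foundations of Differentiable Manifolds and Lie Groups*, GTM 94 (1983), 2.22–2.23.
-/

noncomputable section

open scoped Manifold ContDiff Topology Matrix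
open Set Filter
open Literature.NumberTheory.Transcendental (complexDeRhamCohomology mem_cclosedSmoothForms
  cclosedSmoothForms pullback_mem_cclosedSmoothForms)

namespace Literature.Geometry.Kaehler

/-! ### Pull-back of matrices of forms -/

namespace MatrixForm

variable {E : Type*} [NormedAddCommGroup E] [NormedSpace ℝ E]
  {H : Type*} [TopologicalSpace H] {I : ModelWithCorners ℝ E H}
  {M : Type*} [TopologicalSpace M] [ChartedSpace H M]
  {E' : Type*} [NormedAddCommGroup E'] [NormedSpace ℝ E']
  {H' : Type*} [TopologicalSpace H'] {I' : ModelWithCorners ℝ E' H'}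
  {N : Type*} [TopologicalSpace N] [ChartedSpace H' N] {r k l : ℕ}

variable (I') in
/-- The entrywise **pull-back `f^*A`** of a matrix of forms along `f : N → M` (Kobayashi, Ch. I §1
(1.20): `f^*ω_U`). [cite: Kobayashi1987, Ch. I §1 (1.20)] -/
def pullback (f : N → M) (A : MatrixForm I M r k) : MatrixForm I' N r k :=
  Matrix.of fun a b ↦ (A a b).pullback I' f

/-- Entries of `f^*A` (definitional). [folklore] -/
@[simp]
theorem pullback_apply (f : N → M) (A : MatrixForm I M r k) (a b : Fin r) :
    A.pullback I' f a b = (A a b).pullback I' f :=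
  rfl

/-- `f^*0 = 0`. [folklore] -/
@[simp]
theorem pullback_zero (f : N → M) : (0 : MatrixForm I M r k).pullback I' f = 0 := by
  ext a b : 2
  simp [pullback]

/-- `f^*(A + B) = f^*A + f^*B`. [folklore] -/
theorem pullback_add (f : N → M) (A B : MatrixForm I M r k) :
    (A + B).pullback I' f = A.pullback I' f + B.pullback I' f := by
  ext a b : 2
  simp [pullback]

/-- `f^*(c • A) = c • f^*A` for a complex scalar. [folklore] -/
theorem pullback_smul (f : N → M) (c : ℂ) (A : MatrixForm I M r k) :
    (c • A).pullback I' f = c • A.pullback I' f := by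
  ext a b x v
  simp [pullback, MForm.pullback_apply]

/-- `f^*(g · A) = (g ∘ f) · f^*A`. [folklore] -/
theorem pullback_mulLeft (f : N → M) (g : M → Matrix (Fin r) (Fin r) ℂ) (A : MatrixForm I M r k) :
    (mulLeft g A).pullback I' f = mulLeft (g ∘ f) (A.pullback I' f) := by
  ext a b x v
  simp [pullback, MForm.pullback_apply, mulLeft_apply]

/-- `f^*(A · g) = f^*A · (g ∘ f)`. [folklore] -/
theorem pullback_mulRight (f : N → M) (A : MatrixForm I M r k) (g : M → Matrix (Fin r) (Fin r) ℂ) :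
    (mulRight A g).pullback I' f = mulRight (A.pullback I' f) (g ∘ f) := by
  ext a b x v
  simp [pullback, MForm.pullback_apply, mulRight_apply]

/-- `f^*` of the `0`-forms of a matrix-valued function is the `0`-forms of the composite. [folklore] -/
theorem pullback_ofFun (f : N → M) (g : M → Matrix (Fin r) (Fin r) ℂ) :
    (ofFun (I := I) g).pullback I' f = ofFun (I := I') (g ∘ f) := by
  ext a b x v
  simp [pullback, MForm.pullback_apply, ofFun_apply, MForm.ofFun_apply]

/-- `f^*1 = 1`. [folklore] -/
theorem pullback_one (f : N → M) : (one : MatrixForm I M r 0).pullback I' f = one := by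
  ext a b x v
  simp only [pullback, one, Matrix.of_apply, Matrix.diagonal_apply]
  split_ifs
  · simp [MForm.pullback_apply, MForm.ofFun_apply]
  · simp

/-- The pull-back commutes with complex scalars (the `ℂ`-linearity of `MForm.cpullbackₗ`). [folklore] -/
theorem _root_.Literature.Geometry.Kaehler.MForm.pullback_smul_complex (f : N → M) (c : ℂ)
    (β : MForm I M ℂ k) : (c • β).pullback I' f = c • β.pullback I' f := by
  funext x
  ext v
  simp [MForm.pullback_apply]

/-- The pull-back of a finite sum of forms is the sum of the pull-backs. [folklore] -/
theorem _root_.Literature.Geometry.Kaehler.MForm.pullback_finset_sum {F : Type*} [NormedAddCommGroup F]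
    [NormedSpace ℝ F] {κ : Type*} (s : Finset κ) (f : N → M) (α : κ → MForm I M F k) :
    (∑ c ∈ s, α c).pullback I' f = ∑ c ∈ s, (α c).pullback I' f :=
  map_sum (MForm.pullbackₗ I' f k) α s

/-- **`f^*(A ∧ B) = f^*A ∧ f^*B`** (Warner 2.22(c), entrywise). [cite: WarnerGTM94, 2.22] -/
theorem pullback_wedge (f : N → M) (A : MatrixForm I M r k) (B : MatrixForm I M r l) :
    (A.wedge B).pullback I' f = (A.pullback I' f).wedge (B.pullback I' f) := by
  ext a b : 2
  simp only [pullback_apply, wedge_apply, MForm.pullback_finset_sum, MForm.pullback_wedge]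

/-- `f^*` commutes with degree casts. [folklore] -/
theorem pullback_castDeg {k' : ℕ} (f : N → M) (h : k = k') (A : MatrixForm I M r k) :
    (A.castDeg h).pullback I' f = (A.pullback I' f).castDeg h := by
  ext a b : 2
  simp only [pullback_apply, castDeg_apply, MForm.pullback_castDeg]

/-- **`f^*(Ωᵖ) = (f^*Ω)ᵖ`.** [cite: Kobayashi1987, Ch. II §2 (2.21)] -/
theorem pullback_npow (f : N → M) (Ω : MatrixForm I M r 2) (p : ℕ) :
    (npow Ω p).pullback I' f = npow (Ω.pullback I' f) p := by
  induction p with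
  | zero => rw [npow_zero, npow_zero, pullback_one]
  | succ p ih => rw [npow_succ, npow_succ, pullback_castDeg, pullback_wedge, ih]

/-- `f^*(tr A) = tr(f^*A)`. [folklore] -/
theorem pullback_trace (f : N → M) (A : MatrixForm I M r k) :
    A.trace.pullback I' f = (A.pullback I' f).trace := by
  simp only [Matrix.trace, Matrix.diag_apply, MForm.pullback_finset_sum, pullback_apply]

/-- The value at `x` of the trace only depends on the values of the entries at `x`. [folklore] -/
theorem trace_apply_congr {A A' : MatrixForm I M r k} {x : M} (h : ∀ a b, A a b x = A' a b x) :
    A.trace x = A'.trace x := by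
  simp only [Matrix.trace, Matrix.diag_apply, Finset.sum_apply]
  exact Finset.sum_congr rfl fun a _ ↦ h a a

end MatrixForm

/-! ### The induced cocycle and the induced connection -/

namespace SmoothComplexVectorBundle

variable {ι : Type*} {E : Type*} [NormedAddCommGroup E] [NormedSpace ℂ E]
  {M : Type*} [TopologicalSpace M] [ChartedSpace E M]
  {E' : Type*} [NormedAddCommGroup E'] [NormedSpace ℂ E']
  {N : Type*} [TopologicalSpace N] [ChartedSpace E' N] {r : ℕ}

/-- **The induced cocycle `f⁻¹V`** along a `C^∞` map `f : N → M`: trivialising sets `f⁻¹(U_i)`,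
transition matrices `g_ij ∘ f` (Kobayashi, Ch. I §1: the induced bundle, its transition functions
being those of `E` composed with `f`). [cite: Kobayashi1987, Ch. I §1 (1.20)] -/
def pullback (V : SmoothComplexVectorBundle ι E M r) (f : N → M)
    (hf : ContMDiff 𝓘(ℝ, E') 𝓘(ℝ, E) ∞ f) : SmoothComplexVectorBundle ι E' N r where
  baseSet i := f ⁻¹' V.baseSet i
  isOpen_baseSet i := (V.isOpen_baseSet i).preimage hf.continuous
  exists_mem_baseSet x := V.exists_mem_baseSet (f x)
  coordChange i j := V.coordChange i j ∘ f
  contMDiffOn_coordChange i j a b :=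
    (V.contMDiffOn_coordChange i j a b).comp hf.contMDiffOn fun _ hx ↦ hx
  coordChange_self i x hx := V.coordChange_self i (f x) hx
  coordChange_comp i j k x hx := V.coordChange_comp i j k (f x) hx

/-- The trivialising sets of `f⁻¹V` (definitional). [folklore] -/
@[simp]
theorem pullback_baseSet (V : SmoothComplexVectorBundle ι E M r) (f : N → M)
    (hf : ContMDiff 𝓘(ℝ, E') 𝓘(ℝ, E) ∞ f) (i : ι) : (V.pullback f hf).baseSet i = f ⁻¹' V.baseSet i :=
  rfl

/-- The transition matrices of `f⁻¹V` (definitional). [folklore] -/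
@[simp]
theorem pullback_coordChange (V : SmoothComplexVectorBundle ι E M r) (f : N → M)
    (hf : ContMDiff 𝓘(ℝ, E') 𝓘(ℝ, E) ∞ f) (i j : ι) :
    (V.pullback f hf).coordChange i j = V.coordChange i j ∘ f :=
  rfl

/-- `f⁻¹V` is holomorphic if `V` is and `f` is holomorphic. [cite: Kobayashi1987, Ch. I §1] -/
theorem IsHolomorphic.pullback {V : SmoothComplexVectorBundle ι E M r} (hV : V.IsHolomorphic)
    {f : N → M} (hf : ContMDiff 𝓘(ℝ, E') 𝓘(ℝ, E) ∞ f) (hf' : MDifferentiable 𝓘(ℂ, E') 𝓘(ℂ, E) f) :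
    (V.pullback f hf).IsHolomorphic := fun i j a b ↦
  (hV i j a b).comp hf'.mdifferentiableOn fun _ hx ↦ hx

namespace Connection

variable [IsManifold 𝓘(ℝ, E) ∞ M] [IsManifold 𝓘(ℝ, E') ∞ N]
  {V : SmoothComplexVectorBundle ι E M r}

/-- `d(g ∘ f) = f^*(dg)` at a point of `f⁻¹(U_i ∩ U_j)` for the transition matrices (Warner 2.23,
entrywise). [cite: WarnerGTM94, Prop. 2.23] -/
theorem d_ofFun_coordChange_comp_apply {f : N → M} (hf : ContMDiff 𝓘(ℝ, E') 𝓘(ℝ, E) ∞ f) {i j : ι}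
    {x : N} (hx : f x ∈ V.baseSet i ∩ V.baseSet j) (a b : Fin r) :
    (MatrixForm.ofFun (I := 𝓘(ℝ, E')) (V.coordChange i j ∘ f)).d a b x =
      ((MatrixForm.ofFun (I := 𝓘(ℝ, E)) (V.coordChange i j)).d.pullback 𝓘(ℝ, E') f) a b x := by
  rw [← MatrixForm.pullback_ofFun (I := 𝓘(ℝ, E)) f (V.coordChange i j), MatrixForm.d_apply, MatrixForm.pullback_apply,
    MatrixForm.pullback_apply, MatrixForm.d_apply, MatrixForm.ofFun_apply,
    mextDeriv_pullback_apply (Eventually.of_forall fun z ↦ hf.contMDiffAt)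
      (MForm.smoothAt_ofFun_of_contMDiffAt (V.contMDiffAt_coordChange i j a b hx))]

variable (D : V.Connection)

/-- **The induced connection `f^*D` on `f⁻¹V`**: connection matrices `f^*ω_i` (Kobayashi, Ch. I §1
(1.21): "its connection form is `f^*ω_U`"); the gauge law (1.16) pulls back since `f^*` commutes with
function factors and `d(g_ij ∘ f) = f^*(dg_ij)`. [cite: Kobayashi1987, Ch. I §1 (1.21)] -/
def pullback (f : N → M) (hf : ContMDiff 𝓘(ℝ, E') 𝓘(ℝ, E) ∞ f) : (V.pullback f hf).Connection where
  form i := (D.form i).pullback 𝓘(ℝ, E') f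
  isSmoothFormOn_form i a b x hx :=
    MForm.SmoothAt.pullback (Eventually.of_forall fun z ↦ hf.contMDiffAt) (D.smoothAt_form hx a b)
  form_eq i j x hx a b := by
    change ((D.form j).pullback 𝓘(ℝ, E') f) a b x =
      ((MatrixForm.mulLeft (V.coordChange j i ∘ f) ((D.form i).pullback 𝓘(ℝ, E') f)).mulRight
          (V.coordChange i j ∘ f)) a b x +
        MatrixForm.mulLeft (V.coordChange j i ∘ f)
          (MatrixForm.ofFun (I := 𝓘(ℝ, E')) (V.coordChange i j ∘ f)).d a b x
    have h1 : ((D.form j).pullback 𝓘(ℝ, E') f) a b x =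
        (((MatrixForm.mulLeft (V.coordChange j i) (D.form i)).mulRight (V.coordChange i j) +
          MatrixForm.mulLeft (V.coordChange j i)
            (MatrixForm.ofFun (I := 𝓘(ℝ, E)) (V.coordChange i j)).d).pullback 𝓘(ℝ, E') f) a b x := by
      simp only [MatrixForm.pullback_apply]
      change (D.form j a b (f x)).compContinuousLinearMap (mfderiv 𝓘(ℝ, E') 𝓘(ℝ, E) f x) =
        (((MatrixForm.mulLeft (V.coordChange j i) (D.form i)).mulRight (V.coordChange i j) +
          MatrixForm.mulLeft (V.coordChange j i)
            (MatrixForm.ofFun (I := 𝓘(ℝ, E)) (V.coordChange i j)).d) a b (f x)).compContinuousLinearMap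
          (mfderiv 𝓘(ℝ, E') 𝓘(ℝ, E) f x)
      rw [D.form_eq i j (f x) hx a b, Matrix.add_apply, Pi.add_apply]
    rw [h1, MatrixForm.pullback_add, MatrixForm.pullback_mulRight, MatrixForm.pullback_mulLeft,
      MatrixForm.pullback_mulLeft, Matrix.add_apply, Pi.add_apply]
    congr 1
    exact MatrixForm.mulLeft_apply_congr_right _ fun c ↦
      (d_ofFun_coordChange_comp_apply hf hx c b).symm

/-- The connection matrices of `f^*D` (definitional). [folklore] -/
@[simp]
theorem pullback_form (f : N → M) (hf : ContMDiff 𝓘(ℝ, E') 𝓘(ℝ, E) ∞ f) (i : ι) :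
    (D.pullback f hf).form i = (D.form i).pullback 𝓘(ℝ, E') f :=
  rfl

/-- **`Ω(f^*D) = f^*Ω(D)`** at the points of `f⁻¹(U_i)`: `d(f^*ω) + f^*ω ∧ f^*ω = f^*(dω + ω ∧ ω)`
(Warner 2.22(c), 2.23). [cite: Kobayashi1987, Ch. I §1 (1.12) and (1.21)] -/
theorem curvature_pullback_apply {f : N → M} (hf : ContMDiff 𝓘(ℝ, E') 𝓘(ℝ, E) ∞ f) {i : ι} {x : N}
    (hx : f x ∈ V.baseSet i) (a b : Fin r) :
    (D.pullback f hf).curvature i a b x = ((D.curvature i).pullback 𝓘(ℝ, E') f) a b x := by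
  rw [curvature, curvature, MatrixForm.pullback_add, MatrixForm.pullback_wedge, pullback_form,
    Matrix.add_apply, Matrix.add_apply, Pi.add_apply, Pi.add_apply]
  congr 1
  simp only [MatrixForm.d_apply, MatrixForm.pullback_apply]
  exact mextDeriv_pullback_apply (Eventually.of_forall fun z ↦ hf.contMDiffAt) (D.smoothAt_form hx a b)

/-- `Ω(f^*D)ᵖ = f^*(Ωᵖ)` at the points of `f⁻¹(U_i)`. [cite: Kobayashi1987, Ch. II §2 (2.21)] -/
theorem npow_curvature_pullback_apply {f : N → M} (hf : ContMDiff 𝓘(ℝ, E') 𝓘(ℝ, E) ∞ f) {i : ι}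
    {x : N} (hx : f x ∈ V.baseSet i) (p : ℕ) (a b : Fin r) :
    MatrixForm.npow ((D.pullback f hf).curvature i) p a b x =
      ((MatrixForm.npow (D.curvature i) p).pullback 𝓘(ℝ, E') f) a b x := by
  rw [MatrixForm.pullback_npow]
  exact MatrixForm.npow_apply_congr (fun c d ↦ D.curvature_pullback_apply hf hx c d) p a b

/-- **`ch_p(f⁻¹V, f^*D) = f^* ch_p(V, D)`** at the points of `f⁻¹(U_i)` (Kobayashi, Ch. II,
naturality of the Chern–Weil forms). [cite: Kobayashi1987, Ch. II §1 Axiom 2 and §2 (2.21)] -/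
theorem chernCharacterForm_pullback_apply {f : N → M} (hf : ContMDiff 𝓘(ℝ, E') 𝓘(ℝ, E) ∞ f)
    {i : ι} {x : N} (hx : f x ∈ V.baseSet i) (p : ℕ) :
    (D.pullback f hf).chernCharacterForm p i x =
      (D.chernCharacterForm p i).pullback 𝓘(ℝ, E') f x := by
  have h : (MatrixForm.npow ((D.pullback f hf).curvature i) p).trace x =
      ((MatrixForm.npow (D.curvature i) p).trace.pullback 𝓘(ℝ, E') f) x := by
    rw [MatrixForm.pullback_trace]
    exact MatrixForm.trace_apply_congr fun a b ↦ D.npow_curvature_pullback_apply hf hx p a b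
  rw [chernCharacterForm, chernCharacterForm, Pi.smul_apply, h, MForm.pullback_smul_complex, Pi.smul_apply]

/-- **The pull-back of a global Chern character form of `D` is one of `f^*D`.**
[cite: Kobayashi1987, Ch. II §1 Axiom 2 and §2 Thm. 2.16] -/
theorem IsChernCharacterForm.pullback {D : V.Connection} {p : ℕ} {θ : MForm 𝓘(ℝ, E) M ℂ (2 * p)}
    (hθ : D.IsChernCharacterForm p θ) {f : N → M} (hf : ContMDiff 𝓘(ℝ, E') 𝓘(ℝ, E) ∞ f) :
    (D.pullback f hf).IsChernCharacterForm p (θ.pullback 𝓘(ℝ, E') f) := fun i x hx ↦ by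
  rw [D.chernCharacterForm_pullback_apply hf hx p]
  change (θ (f x)).compContinuousLinearMap _ = (D.chernCharacterForm p i (f x)).compContinuousLinearMap _
  rw [hθ i (f x) hx]

end Connection

/-! ### Naturality in de Rham cohomology -/

section DeRham

variable [IsManifold 𝓘(ℝ, E) ∞ M] [IsManifold 𝓘(ℝ, E') ∞ N]

/-- **`f^*[ch_k(V, D)]` is a Chern–Weil class of `f⁻¹V`**: the pull-back in de Rham cohomology of the
class of a global `k`-th Chern character form of `D` is the class of a global `k`-th Chern character
form of `f^*D`. [cite: Kobayashi1987, Ch. II §1 Axiom 2] -/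
theorem map_mk_mem_chernCharacterClassSet {V : SmoothComplexVectorBundle ι E M r} (D : V.Connection)
    {k : ℕ} {θ : MForm 𝓘(ℝ, E) M ℂ (2 * k)} (hs : IsSmoothForm θ) (hc : IsClosedForm θ)
    (hθ : D.IsChernCharacterForm k θ) {f : N → M} (hf : ContMDiff 𝓘(ℝ, E') 𝓘(ℝ, E) ∞ f) :
    complexDeRhamCohomology.map E' hf (2 * k)
        (complexDeRhamCohomology.mk E M (2 * k) ⟨θ, mem_cclosedSmoothForms hs hc⟩) ∈
      (V.pullback f hf).chernCharacterClassSet k := by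
  rw [complexDeRhamCohomology.map_mk]
  have hmem := Literature.NumberTheory.Transcendental.pullback_mem_closedSmoothForms hf
    ((mem_closedSmoothForms_iff θ).2 ⟨hs, hc⟩)
  exact ⟨D.pullback f hf, θ.pullback 𝓘(ℝ, E') f, hmem.1, hmem.2, hθ.pullback hf, rfl⟩

/-- The pull-back of the unit class is the unit class: `f^*[1] = [1]`. [folklore] -/
theorem _root_.Literature.NumberTheory.Transcendental.complexDeRhamCohomology.map_one {f : N → M}
    (hf : ContMDiff 𝓘(ℝ, E') 𝓘(ℝ, E) ∞ f) :
    complexDeRhamCohomology.map E' hf 0 (complexDeRhamCohomology.one E M) =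
      complexDeRhamCohomology.one E' N := by
  rw [complexDeRhamCohomology.one, complexDeRhamCohomology.map_mk, complexDeRhamCohomology.one]
  exact congrArg _ (Subtype.ext (funext fun x ↦ ContinuousAlternatingMap.ext fun v ↦ by
    simp [Literature.NumberTheory.Transcendental.coe_cclosedOne, MForm.pullback_apply, MForm.ofFun_apply]))

end DeRham

section DeRhamUniv

universe u v w

variable {ι : Type v} {E : Type u} [NormedAddCommGroup E] [NormedSpace ℂ E] [FiniteDimensional ℂ E]
  {M : Type v} [TopologicalSpace M] [ChartedSpace E M] [IsManifold 𝓘(ℝ, E) ∞ M]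
  {E' : Type w} [NormedAddCommGroup E'] [NormedSpace ℂ E'] [FiniteDimensional ℂ E']
  {N : Type v} [TopologicalSpace N] [ChartedSpace E' N] [IsManifold 𝓘(ℝ, E') ∞ N] {r : ℕ}

/-- **Naturality of the Chern character, `ch_k(f⁻¹V) = f^* ch_k(V)`** in de Rham cohomology
(Kobayashi, Ch. II §1, Axiom 2: "`c(f⁻¹E) = f^*(c(E))`"), for a cocycle carrying a connection and
granted the two Chern–Weil facts (gluing on `M`, independence of the connection on `M` and on `N`;
all discharged in the tree: `exists_isChernCharacterForm_holds`, `mk_eq_mk_of_isChernCharacterForm_holds`).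
[cite: Kobayashi1987, Ch. II §1 Axiom 2] -/
theorem chernCharacterDeRham_pullback (hA : exists_isChernCharacterForm E M)
    (hB : mk_eq_mk_of_isChernCharacterForm E M) (hB' : mk_eq_mk_of_isChernCharacterForm E' N)
    {V : SmoothComplexVectorBundle ι E M r} (D : V.Connection) {f : N → M}
    (hf : ContMDiff 𝓘(ℝ, E') 𝓘(ℝ, E) ∞ f) (k : ℕ) :
    (V.pullback f hf).chernCharacterDeRham k =
      complexDeRhamCohomology.map E' hf (2 * k) (V.chernCharacterDeRham k) := by
  cases k with
  | zero =>
    rw [chernCharacterDeRham_zero, chernCharacterDeRham_zero, map_smul,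
      Literature.NumberTheory.Transcendental.complexDeRhamCohomology.map_one]
  | succ k =>
    obtain ⟨θ, hs, hc, hθ⟩ := hA V D (k + 1)
    have hmem := Literature.NumberTheory.Transcendental.pullback_mem_closedSmoothForms hf
      ((mem_closedSmoothForms_iff θ).2 ⟨hs, hc⟩)
    rw [chernCharacterDeRham_eq_mk hB D hs hc hθ, complexDeRhamCohomology.map_mk,
      chernCharacterDeRham_eq_mk hB' (D.pullback f hf) hmem.1 hmem.2 (hθ.pullback hf)]

end DeRhamUniv

/-! ### The flat connection of a global frame; vanishing of the Chern character on a trivialising set -/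

namespace Connection

variable [IsManifold 𝓘(ℝ, E) ∞ M]

omit [IsManifold 𝓘(ℝ, E) ∞ M] in
/-- On a trivialising set which is all of `M`, the transition matrix `g_{i₀ i₀}` is the constant `1`.
[folklore] -/
theorem _root_.Literature.Geometry.Kaehler.SmoothComplexVectorBundle.coordChange_self_eq_one_of_baseSet_eq_univ
    (V : SmoothComplexVectorBundle ι E M r) {i₀ : ι}
    (h : V.baseSet i₀ = univ) : V.coordChange i₀ i₀ = fun _ ↦ 1 :=
  funext fun x ↦ V.coordChange_self i₀ x (h ▸ mem_univ x)

/-- **The flat connection of a global frame.** If the trivialising set `U_{i₀}` is all of `M`, the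
frame `s_{i₀}` is global and `D s_{i₀} = 0` is a connection on `V`: in the frame `s_j` its matrix is
the gauge term `ω_j = g_{j i₀} dg_{i₀ j}` (Kobayashi, Ch. I §1 (1.7), (1.16); the gauge law is the
cocycle identity of the gauge terms, `gaugeTerm_cocycle`). [cite: Kobayashi1987, Ch. I §1 (1.7) and (1.16)] -/
def flat (V : SmoothComplexVectorBundle ι E M r) (i₀ : ι) (h : V.baseSet i₀ = univ) : V.Connection where
  form j := V.gaugeTerm i₀ j
  isSmoothFormOn_form j a b x hx := V.smoothAt_gaugeTerm i₀ j a b ⟨h ▸ mem_univ x, hx⟩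
  form_eq _ _ x hx a b := V.gaugeTerm_cocycle (h ▸ mem_univ x) hx.1 hx.2 a b

/-- In its own frame the flat connection of the global frame `s_{i₀}` has matrix `0`
(`g_{i₀ i₀} = 1`, `d1 = 0`). [cite: Kobayashi1987, Ch. I §1 (1.7)] -/
theorem flat_form_self (V : SmoothComplexVectorBundle ι E M r) (i₀ : ι) (h : V.baseSet i₀ = univ) :
    (flat V i₀ h).form i₀ = 0 := by
  refine Matrix.ext fun a b ↦ funext fun x ↦ ?_
  change V.gaugeTerm i₀ i₀ a b x = 0
  rw [gaugeTerm, V.coordChange_self_eq_one_of_baseSet_eq_univ h, MatrixForm.ofFun_const_one,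
    MatrixForm.mulLeft_apply]
  simp [MatrixForm.one_d_apply]

/-- The flat connection of a global frame is flat in that frame: `Ω_{i₀} = d0 + 0 ∧ 0 = 0`.
[cite: Kobayashi1987, Ch. I §1 (1.12)] -/
theorem curvature_flat_self (V : SmoothComplexVectorBundle ι E M r) (i₀ : ι) (h : V.baseSet i₀ = univ) :
    (flat V i₀ h).curvature i₀ = 0 := by
  rw [curvature, flat_form_self, MatrixForm.d_zero, MatrixForm.zero_wedge, add_zero]

/-- Its Chern character forms of positive degree vanish in the global frame. [cite: Kobayashi1987, Ch. II §2 (2.21)] -/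
theorem chernCharacterForm_flat_self_succ (V : SmoothComplexVectorBundle ι E M r) (i₀ : ι)
    (h : V.baseSet i₀ = univ) (p : ℕ) : (flat V i₀ h).chernCharacterForm (p + 1) i₀ = 0 := by
  rw [chernCharacterForm, curvature_flat_self, MatrixForm.npow_zero_succ]
  simp [Matrix.trace]

/-- **`0` is a global `(p+1)`-st Chern character form of the flat connection of a global frame**
(in every frame `s_j`, by frame independence `ch(E, D)|_{U_j}(x) = ch(E, D)|_{U_{i₀}}(x) = 0`).
[cite: Kobayashi1987, Ch. II §2 (2.21)] -/
theorem isChernCharacterForm_zero_flat (V : SmoothComplexVectorBundle ι E M r) (i₀ : ι)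
    (h : V.baseSet i₀ = univ) (p : ℕ) : (flat V i₀ h).IsChernCharacterForm (p + 1) 0 := fun j x hx ↦ by
  rw [(flat V i₀ h).chernCharacterForm_apply_eq (h ▸ mem_univ x) hx (p + 1),
    chernCharacterForm_flat_self_succ]

/-- **On a cocycle with a global frame every global Chern character form of positive degree is
exact.** If some trivialising set `U_{i₀}` is all of `M`, then for every connection `D` on `V` and
every global smooth closed `(p+1)`-st Chern character form `θ` of `D`, `[θ] = 0` in
`H^{2p+2}_dR(M; ℂ)`: by the transgression formula (Kobayashi (2.10), `Connection.exists_transgression`)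
between `D` and the flat connection of the global frame, whose Chern character forms vanish.
[cite: Kobayashi1987, Ch. II §2 (2.10) and (2.21)] -/
theorem IsChernCharacterForm.mk_eq_zero_of_baseSet_eq_univ {V : SmoothComplexVectorBundle ι E M r}
    {i₀ : ι} (h : V.baseSet i₀ = univ) {D : V.Connection} {p : ℕ}
    {θ : MForm 𝓘(ℝ, E) M ℂ (2 * (p + 1))} (hs : IsSmoothForm θ) (hc : IsClosedForm θ)
    (hθ : D.IsChernCharacterForm (p + 1) θ) :
    complexDeRhamCohomology.mk E M (2 * (p + 1)) ⟨θ, mem_cclosedSmoothForms hs hc⟩ = 0 := by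
  obtain ⟨φ, hφ, hdφ⟩ := exists_transgression (flat V i₀ h) D p
  rw [← (complexDeRhamCohomology.mk E M (2 * (p + 1))).map_zero,
    Literature.NumberTheory.Transcendental.complexDeRhamCohomology.mk_eq_mk_iff, Submodule.coe_zero,
    sub_zero]
  change θ ∈ Submodule.span ℂ (mextDeriv ''
    (Literature.NumberTheory.Transcendental.csmoothForms E M (2 * p + 1) :
      Set (MForm 𝓘(ℝ, E) M ℂ (2 * p + 1))))
  refine Submodule.subset_span
    ⟨((((p + 1).factorial : ℂ)⁻¹ * (-1 / (2 * Real.pi * Complex.I)) ^ (p + 1))) • φ, ?_, ?_⟩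
  · exact (Literature.NumberTheory.Transcendental.mem_csmoothForms_iff _).mpr (hφ.smul_complex _)
  · rw [Literature.NumberTheory.Transcendental.mextDeriv_smul_complex_holds]
    funext x
    obtain ⟨i, hi⟩ := V.exists_mem_baseSet x
    have h0 : (MatrixForm.npow ((flat V i₀ h).curvature i) (p + 1)).trace x = 0 := by
      rw [(flat V i₀ h).trace_npow_curvature_apply_eq (h ▸ mem_univ x) hi (p + 1),
        curvature_flat_self, MatrixForm.npow_zero_succ]
      simp [Matrix.trace]
    rw [Pi.smul_apply, hdφ i x hi, hθ i x hi, h0, sub_zero, chernCharacterForm, Pi.smul_apply]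

/-- **The Chern character dies on every trivialising open set** (the mechanism of Voisin I, proof of
Thm. 11.33: "the Chern class `c₁(Lᵢ)` vanishes on `X − Dᵢ`, since `Lᵢ` is trivial on `X − Dᵢ`", in
every rank and every positive degree). For an open subset `W` of `M` contained in a trivialising set
`U_{i₀}` of the cocycle `V`, every connection `D` on `V` and every global smooth closed `(p+1)`-st
Chern character form `θ` of `D`, the restriction of `[θ]` to the open submanifold `W` vanishes in
`H^{2p+2}_dR(W; ℂ)`: `θ|_W` is a Chern character form of the induced connection on `V|_W`, which has
the global frame `s_{i₀}|_W`. [cite: VoisinHodgeI2002, Thm. 11.33 (proof)]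
[cite: Kobayashi1987, Ch. II §2 (2.10)] -/
theorem IsChernCharacterForm.map_mk_eq_zero_of_subset_baseSet {V : SmoothComplexVectorBundle ι E M r}
    {D : V.Connection} {p : ℕ} {θ : MForm 𝓘(ℝ, E) M ℂ (2 * (p + 1))} (hs : IsSmoothForm θ)
    (hc : IsClosedForm θ) (hθ : D.IsChernCharacterForm (p + 1) θ) (W : TopologicalSpace.Opens M)
    {i₀ : ι} (hW : (W : Set M) ⊆ V.baseSet i₀) :
    complexDeRhamCohomology.map E
        (fun z ↦ contMDiff_subtype_val z :
          ContMDiff 𝓘(ℝ, E) 𝓘(ℝ, E) ∞ (Subtype.val : W → M)) (2 * (p + 1))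
        (complexDeRhamCohomology.mk E M (2 * (p + 1)) ⟨θ, mem_cclosedSmoothForms hs hc⟩) = 0 := by
  have hf : ContMDiff 𝓘(ℝ, E) 𝓘(ℝ, E) ∞ (Subtype.val : W → M) := fun z ↦ contMDiff_subtype_val z
  have hmem := Literature.NumberTheory.Transcendental.pullback_mem_closedSmoothForms hf
    ((mem_closedSmoothForms_iff θ).2 ⟨hs, hc⟩)
  have huniv : (V.pullback Subtype.val hf).baseSet i₀ = univ :=
    eq_univ_of_forall fun x ↦ hW x.2
  rw [complexDeRhamCohomology.map_mk]
  exact IsChernCharacterForm.mk_eq_zero_of_baseSet_eq_univ huniv hmem.1 hmem.2 (hθ.pullback hf)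

/-- The same, for the element of `chernCharacterClassSet`: every Chern–Weil class of positive degree of
`V` restricts to `0` on an open subset of a trivialising set. [cite: VoisinHodgeI2002, Thm. 11.33 (proof)] -/
theorem map_eq_zero_of_mem_chernCharacterClassSet_of_subset_baseSet
    {V : SmoothComplexVectorBundle ι E M r} {p : ℕ} {c : complexDeRhamCohomology E M (2 * (p + 1))}
    (hc : c ∈ V.chernCharacterClassSet (p + 1)) (W : TopologicalSpace.Opens M) {i₀ : ι}
    (hW : (W : Set M) ⊆ V.baseSet i₀) :
    complexDeRhamCohomology.map E
        (fun z ↦ contMDiff_subtype_val z :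
          ContMDiff 𝓘(ℝ, E) 𝓘(ℝ, E) ∞ (Subtype.val : W → M)) (2 * (p + 1)) c = 0 := by
  obtain ⟨D, θ, hs, hc, hθ, rfl⟩ := hc
  exact hθ.map_mk_eq_zero_of_subset_baseSet hs hc W hW

end Connection

end SmoothComplexVectorBundle

end Literature.Geometry.Kaehler
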